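import Summits.QuantumFields.BalabanUV.T4Continuum.Support.NE7K1LinStripClassNN
import Summits.QuantumFields.BalabanUV.T4Continuum.Support.NE7K1LinStripClassKLConsts
import Summits.QuantumFields.BalabanUV.T4Continuum.Support.NE7K1LinBlochSymbolScaled
import Summits.QuantumFields.BalabanUV.T4Continuum.Support.NE7K1LinBlochSymbolFold

/-!
# NE7K1LinStripClassKL — row NE7 (node U5), candidate route HOM, path H1L, cell K1-lin(s): NEEDS-ESTIMATE #E1, R-E1 TRANCHE B —
# THE SCALED, FOLDED BLOCK-MEAN MULTIPLIER `n²·kLfold_L(q∕n)` (the Laplacian symbol of the hard Schur complement `K_L` on the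
# `ξ = 1∕n` lattice, files 47–55) IS A MEMBER OF THE CLASS `S` AT EVERY MESH `n ≥ 1`, WITH CONSTANTS IN `d` ALONE

Lineage `b2b-balaban-t4-ne7-p2` (CRUX PROVER NE7 #2), generation 76; file 65.  Files 62–64: the class `SymbS n σ r C_S C_up`, the uniform
zero-free strip of `ES n σ a` over it, convexity, `Δ^ξ_n + m² ∈ S`.  Files 52 ∕ 55 (gen 74) typed, in b04's shapes and UNIFORMLY IN `n`, the
scaled multiplier's modulus bound (`norm_kL_scaled_le`), its floor against `Δ^ξ_n` (`re_kL_scaled_ge_DeltaXir_sub_sq`) and the folded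
object `kLfold = k_L ∘ fold` (`kLfold_add_two_pi`, `norm_kLfold_le`, `kLfold_eq_kL`, `differentiableAt_kLfold`).  THIS FILE assembles them
into class membership ([folklore]; no new estimate; the constants `rK, CK, CupK` in `d` ALONE and their admissibility are file 65a
`NE7K1LinStripClassKLConsts`): §2 the scaling map `sclV n q = q∕n`; §3 **`scaledKL L n q = n²·kLfold L (q∕n)`** with
(S1) `2πn`-periodicity, (S2) holomorphy on the tube `|Im q_ν| ≤ 2r_K < κ_F`, (S3) reality; §4 (S4) THE FLOOR FOR ALL REAL `x` (fold `x∕n`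
into the zone, carry `Δ^ξ_n` along by periodicity, file 52's floor with `y = √(Σ η²) < κ_F`); §5 (S5) the fat bound UNIFORM IN `n`
(`n = 1`: `norm_kLfold_le`; `n ≥ 2`: `kLfold_eq_kL` on the scaled fat region + the quadratic vanishing `norm_kL_scaled_le`);
§6 **`symbS_scaledKL : SymbS n (scaledKL L n) (rK d) (CK d) (CupK d)`** for EVERY `n ≥ 1`, `L ≥ 1`.  The segment
`σ_s^{(n)} = (1−s)Δ^ξ_n + s·scaledKL` (the two-cutoff line's symbol) and the tranche-B headline are file 66.

HONEST FRAMING: [folklore] change of variables + bookkeeping over files 47–55; constants existence-grade, `d`-only (free of `s`, `n`, `L`,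
the torus and the level); nothing of Bałaban's asserted; no `sorry`.  Census only; NE7 NOT PRINTED ∕ NOT PROVED; spine 0∕9; FIXED FINITE
T⁴, rung (B)+1; NOT infinite volume, NOT mass gap, NOT Clay.  HONEST DEPENDENCY: continuum YM on T⁴ ⇐ BetaPertH ∧ nine spine estimates
(0/9 proved); BetaPertH ⇐ (D1) ∧ (D4) ∧ CAP+tail; G-an2-4 gates asym, D1 and NE2/3/4.
-/

noncomputable section

open Finset Complex Set

namespace Summit.QuantumFields.BalabanUV.T4Continuum.NE7K1LinStripClassKL

open Literature.MathematicalPhysics.QuantumFieldTheory.Balaban1983to89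
open Literature.MathematicalPhysics.QuantumFieldTheory.Balaban1983to89.B4Strip
open Literature.MathematicalPhysics.QuantumFieldTheory.Balaban1983to89.B4StripCauchy
open Literature.MathematicalPhysics.QuantumFieldTheory.Balaban1983to89.B4StripSums
open Literature.MathematicalPhysics.QuantumFieldTheory.Balaban1983to89.B5Strip145Analytic
open NE7K1LinStripClass NE7K1LinStripClassCauchy NE7K1LinStripClassNN
open NE7K1LinBlochDenominator NE7K1LinBlochSymbol NE7K1LinBlochDenominatorFat NE7K1LinBlochSymbolFloor
open NE7K1LinBlochSymbolScaled NE7K1LinBlochSymbolFold NE7K1LinStripClassKLConsts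

variable {d : ℕ}

/-! ### §2 The scaling map `q ↦ q∕n` -/

/-- `q∕n`. [folklore] -/
def sclV (n : ℕ) (q : Fin d → ℂ) : Fin d → ℂ := fun μ => q μ / (n : ℂ)

/-- real and imaginary parts of `q∕n`. [folklore] -/
theorem sclV_re_im (n : ℕ) (q : Fin d → ℂ) (μ : Fin d) :
    (sclV n q μ).re = (q μ).re / n ∧ (sclV n q μ).im = (q μ).im / n := div_nat_re_im (q μ) n

/-- `q ↦ q∕n` is the scalar action of `n⁻¹`, hence holomorphic. [folklore] -/
theorem differentiableAt_sclV (n : ℕ) (q : Fin d → ℂ) : DifferentiableAt ℂ (sclV n : (Fin d → ℂ) → Fin d → ℂ) q := by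
  have e : (sclV n : (Fin d → ℂ) → Fin d → ℂ) = fun p => ((n : ℂ)⁻¹) • p := by
    funext p μ; simp [sclV, div_eq_inv_mul]
  rw [e]
  exact (differentiableAt_id (𝕜 := ℂ) (x := q)).const_smul ((n : ℂ)⁻¹)

/-- scaling an updated coordinate: `(q[μ ↦ q_μ + 2πn])∕n = (q∕n)[μ ↦ q_μ∕n + 2π]`. [folklore] -/
theorem sclV_update (n : ℕ) (hn : n ≠ 0) (q : Fin d → ℂ) (μ : Fin d) :
    sclV n (Function.update q μ (q μ + 2 * Real.pi * n)) = Function.update (sclV n q) μ (sclV n q μ + 2 * Real.pi) := by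
  have hn' : (n : ℂ) ≠ 0 := Nat.cast_ne_zero.mpr hn
  funext ν
  by_cases hν : ν = μ
  · subst hν
    simp only [sclV, Function.update_self]
    field_simp
  · simp only [sclV, Function.update_of_ne hν]

/-- the tube `|Im q_ν| ≤ 2r_K` scales into the open strip `|Im| < κ_F` (every `n ≥ 1`). [folklore] -/
theorem sclV_im_lt {n : ℕ} (hn : 1 ≤ n) {q : Fin d → ℂ} (hq : ∀ ν, |(q ν).im| ≤ 2 * rK d) (ν : Fin d) :
    |(sclV n q ν).im| < kappaF d := by
  have hn0 : (0 : ℝ) < n := by exact_mod_cast (show 0 < n by omega)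
  have hn1 : (1 : ℝ) ≤ n := by exact_mod_cast hn
  obtain ⟨_, h2, _⟩ := rK_facts d
  rw [(sclV_re_im n q ν).2, abs_div, abs_of_pos hn0, div_lt_iff₀ hn0]
  have hκ := kappaF_pos d
  calc |(q ν).im| ≤ 2 * rK d := hq ν
    _ < kappaF d := h2
    _ ≤ kappaF d * n := by nlinarith

/-! ### §3 The scaled folded multiplier: periodicity, holomorphy, reality -/

/-- **THE SCALED FOLDED BLOCK-MEAN MULTIPLIER** `n²·kLfold_L(q∕n)` — the Laplacian symbol of the hard block-mean Schur complement `K_L`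
seen from the `ξ = 1∕n` lattice (the object that replaces b04's `S_ξ`-sum `Δ^ξ_n` on the two-cutoff line at `s = 1`). [folklore] -/
def scaledKL (L : ℕ) [NeZero L] (n : ℕ) (q : Fin d → ℂ) : ℂ := (n : ℂ) ^ 2 * kLfold L (sclV n q)

/-- (S1): `2πn`-periodicity in every coordinate. [folklore] -/
theorem scaledKL_periodic (L : ℕ) [NeZero L] {n : ℕ} (hn : n ≠ 0) (q : Fin d → ℂ) (μ : Fin d) :
    scaledKL L n (Function.update q μ (q μ + 2 * Real.pi * n)) = scaledKL L n q := by
  unfold scaledKL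
  rw [sclV_update n hn q μ, kLfold_add_two_pi]

/-- (S2): holomorphy on the tube `|Im q_ν| ≤ 2r_K`, every `n ≥ 1`. [folklore] -/
theorem differentiableAt_scaledKL (L : ℕ) [NeZero L] {n : ℕ} (hn : 1 ≤ n) {q : Fin d → ℂ}
    (hq : ∀ ν, |(q ν).im| ≤ 2 * rK d) : DifferentiableAt ℂ (scaledKL L n) q := by
  have h1 : DifferentiableAt ℂ (kLfold (d := d) L) (sclV n q) := differentiableAt_kLfold L (sclV_im_lt hn hq)
  have h2 := (h1.comp q (differentiableAt_sclV n q)).const_mul ((n : ℂ) ^ 2)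
  exact h2

/-- folding a real vector gives a real vector. [folklore] -/
theorem foldV_ofRealVec (t : Fin d → ℝ) : foldV (ofRealVec t) = ofRealVec (fun μ => foldR (t μ)) := by
  funext μ
  apply Complex.ext
  · rw [show foldV (ofRealVec t) μ = foldC (ofRealVec t μ) from rfl, foldC_re]; simp [ofRealVec]
  · rw [show foldV (ofRealVec t) μ = foldC (ofRealVec t μ) from rfl, foldC_im]; simp [ofRealVec]

/-- (S3): reality on real momenta. [folklore] -/
theorem scaledKL_real (L : ℕ) [NeZero L] (n : ℕ) (s : Fin d → ℝ) : (scaledKL L n (ofRealVec s)).im = 0 := by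
  unfold scaledKL kLfold
  have e : sclV n (ofRealVec s) = ofRealVec (fun μ => s μ / n) := by
    funext μ; simp [sclV, ofRealVec]
  rw [e, foldV_ofRealVec, kL_ofReal]
  have : ((n : ℂ) ^ 2 * (((kLr L fun μ => foldR (s μ / ↑n)) : ℝ) : ℂ))
      = (((n : ℝ) ^ 2 * kLr L (fun μ => foldR (s μ / ↑n)) : ℝ) : ℂ) := by push_cast; ring
  rw [this, Complex.ofReal_im]

/-! ### §4 (S4): the floor for all real `x` -/

/-- `S_ξ` (real form) is `2π`-periodic after scaling: `Sxir n (n·(t − 2πm)) = Sxir n (n·t)`, i.e. `Sxir n (n·foldR t) = Sxir n (n·t)`. [folklore] -/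
theorem Sxir_fold (n : ℕ) (hn : n ≠ 0) (x : ℝ) : Sxir n (n * foldR (x / n)) = Sxir n x := by
  have hn' : (n : ℝ) ≠ 0 := Nat.cast_ne_zero.mpr hn
  unfold Sxir
  rw [foldR_eq_sub]
  have e : (n : ℝ) * (x / n - (toIcoDiv Real.two_pi_pos (-Real.pi) (x / n) : ℝ) * (2 * Real.pi)) / n
      = x / n - (toIcoDiv Real.two_pi_pos (-Real.pi) (x / n) : ℝ) * (2 * Real.pi) := by field_simp
  rw [e, Real.cos_sub_int_mul_two_pi]

/-- `Δ^ξ_n` is unchanged by folding every coordinate of `x∕n` into the zone. [folklore] -/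
theorem DeltaXir_fold (n : ℕ) (hn : n ≠ 0) (x : Fin d → ℝ) :
    DeltaXir n 0 (fun μ => n * foldR (x μ / n)) = DeltaXir n 0 x := by
  unfold DeltaXir
  congr 1
  exact Finset.sum_congr rfl (fun μ _ => Sxir_fold n hn (x μ))

/-- the folded point: `foldV((x + iη)∕n) = (x′ + iη)∕n` with `x′_μ = n·foldR(x_μ∕n)`. [folklore] -/
theorem foldV_sclV_cpt (n : ℕ) (hn : n ≠ 0) (x η : Fin d → ℝ) :
    foldV (sclV n (cpt x η)) = fun μ => (((n * foldR (x μ / n) : ℝ) : ℂ) + (η μ : ℂ) * I) / (n : ℂ) := by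
  have hn' : (n : ℂ) ≠ 0 := Nat.cast_ne_zero.mpr hn
  have hnr : (n : ℝ) ≠ 0 := Nat.cast_ne_zero.mpr hn
  funext μ
  have hre : (sclV n (cpt x η) μ).re = x μ / n := by rw [(sclV_re_im n _ μ).1]; simp [cpt]
  have him : (sclV n (cpt x η) μ).im = η μ / n := by rw [(sclV_re_im n _ μ).2]; simp [cpt]
  have e : ((((n * foldR (x μ / n) : ℝ) : ℂ) + (η μ : ℂ) * I) / (n : ℂ))
      = (((foldR (x μ / n) : ℝ) : ℂ)) + ((η μ / n : ℝ) : ℂ) * I := by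
    push_cast; field_simp
  apply Complex.ext
  · rw [show foldV (sclV n (cpt x η)) μ = foldC (sclV n (cpt x η) μ) from rfl, foldC_re, hre, e]; simp
  · rw [show foldV (sclV n (cpt x η)) μ = foldC (sclV n (cpt x η) μ) from rfl, foldC_im, him, e]; simp

/-- **(S4) THE FLOOR, ALL REAL `x`, EVERY `n ≥ 1`**: `Δ^ξ_n(x) − C_K·Σ_ν η_ν² ≤ Re[n²·kLfold_L((x + iη)∕n)]` for `|η_ν| ≤ 2r_K`
(file 52's zone floor at the folded point, `y = √(Σ η²)`). [folklore] -/
theorem scaledKL_floor (L : ℕ) [NeZero L] {n : ℕ} (hn : 1 ≤ n) (x η : Fin d → ℝ) (hη : ∀ ν, |η ν| ≤ 2 * rK d) :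
    DeltaXir n 0 x - CK d * ∑ ν, η ν ^ 2 ≤ (scaledKL L n (cpt x η)).re := by
  have hn0 : n ≠ 0 := by omega
  have hnr : (0 : ℝ) < n := by exact_mod_cast (show 0 < n by omega)
  have hn1 : (1 : ℝ) ≤ n := by exact_mod_cast hn
  set x' : Fin d → ℝ := fun μ => n * foldR (x μ / n) with hx'
  -- the folded real parts lie in the zone `|x′_μ| ≤ πn`
  have hx'z : ∀ μ, |x' μ| ≤ Real.pi * n := by
    intro μ
    obtain ⟨h1, h2⟩ := foldR_mem (x μ / n)
    simp only [hx']
    rw [abs_le]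
    constructor <;> nlinarith
  -- `y = √(Σ η²)`
  set y : ℝ := Real.sqrt (∑ ν, η ν ^ 2) with hy
  have hS0 : 0 ≤ ∑ ν, η ν ^ 2 := Finset.sum_nonneg (fun ν _ => sq_nonneg _)
  have hy0 : 0 ≤ y := Real.sqrt_nonneg _
  have hy2 : y ^ 2 = ∑ ν, η ν ^ 2 := Real.sq_sqrt hS0
  have hηy : ∀ μ, |η μ| ≤ y := by
    intro μ
    rw [hy, ← Real.sqrt_sq_eq_abs]
    exact Real.sqrt_le_sqrt (Finset.single_le_sum (fun ν _ => sq_nonneg (η ν)) (Finset.mem_univ μ))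
  obtain ⟨_, _, _, h4, _, _⟩ := rK_facts d
  have hκ := kappaF_pos d
  have hyR : y < kappaF d * n := by
    have hS : ∑ ν, η ν ^ 2 ≤ (d : ℝ) * (2 * rK d) ^ 2 := by
      calc ∑ ν, η ν ^ 2 ≤ ∑ _ν : Fin d, (2 * rK d) ^ 2 := by
            apply Finset.sum_le_sum; intro ν _
            rw [← sq_abs]; exact pow_le_pow_left₀ (abs_nonneg _) (hη ν) 2
        _ = d * (2 * rK d) ^ 2 := by simp
    have h1 : y < kappaF d := by
      rw [hy, Real.sqrt_lt' hκ]; linarith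
    calc y < kappaF d := h1
      _ ≤ kappaF d * n := by nlinarith
  have key := re_kL_scaled_ge_DeltaXir_sub_sq L hn hx'z hy0 hyR hηy
  rw [DeltaXir_fold n hn0 x, hy2] at key
  -- identify the folded point with `kLfold`'s argument
  have e : scaledKL L n (cpt x η) = (n : ℂ) ^ 2 * kL L (fun μ => (((x' μ : ℝ) : ℂ) + (η μ : ℂ) * I) / (n : ℂ)) := by
    unfold scaledKL kLfold
    rw [foldV_sclV_cpt n hn0 x η]
  rw [e]
  unfold CK
  exact key

/-! ### §5 (S5): the fat bound, uniform in `n` -/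

/-- on the fat region `Fat d r_K` with `n ≥ 2`, the scaled point lies in the closed zone with small imaginary parts. [folklore] -/
theorem sclV_fat_zone {n : ℕ} (hn : 2 ≤ n) {q : Fin d → ℂ} (hq : q ∈ Fat d (rK d)) (ν : Fin d) :
    (-Real.pi ≤ (sclV n q ν).re ∧ (sclV n q ν).re ≤ Real.pi) ∧ |(sclV n q ν).im| ≤ 2 * rK d := by
  have hnr : (2 : ℝ) ≤ n := by exact_mod_cast hn
  have hn0 : (0 : ℝ) < n := by linarith
  have hπ := Real.pi_pos
  have hπ3 := Real.pi_gt_three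
  obtain ⟨hr4, _⟩ := rK_facts d
  obtain ⟨h1, h2⟩ := hq ν
  rw [(sclV_re_im n q ν).1, (sclV_re_im n q ν).2]
  refine ⟨?_, ?_⟩
  · rw [abs_le] at h1
    constructor
    · rw [le_div_iff₀ hn0]; nlinarith
    · rw [div_le_iff₀ hn0]; nlinarith
  · rw [abs_div, abs_of_pos hn0, div_le_iff₀ hn0]
    have := (rK_pos d).le
    nlinarith

/-- **(S5) `‖n²·kLfold_L(q∕n)‖ ≤ 16d∕c_F(d)` on `Fat d r_K`, EVERY `n ≥ 1`** (`n = 1`: the folded bound; `n ≥ 2`: the quadratic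
vanishing of file 52 on the zone). [folklore] -/
theorem norm_scaledKL_le (L : ℕ) [NeZero L] {n : ℕ} (hn : 1 ≤ n) {q : Fin d → ℂ} (hq : q ∈ Fat d (rK d)) :
    ‖scaledKL L n q‖ ≤ CupK d := by
  obtain ⟨hr4, h2κ, h2N, _, hd16, _⟩ := rK_facts d
  have hκ8 := kappaF_le_eighth d
  have hc := cF_le_cN d
  have hcF := cF_pos d
  have hcN := cN_pos d
  have hd : (0:ℝ) ≤ d := Nat.cast_nonneg d
  unfold scaledKL CupK
  rcases Nat.lt_or_ge n 2 with hlt | hge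
  · -- `n = 1`
    have hn1 : n = 1 := by omega
    subst hn1
    have e : sclV 1 q = q := by funext μ; simp [sclV]
    rw [e, Nat.cast_one, one_pow, one_mul]
    exact norm_kLfold_le L (fun ν => (hq ν).2.trans (by linarith))
  · -- `n ≥ 2`: fold is the identity on the scaled fat region, then the quadratic bound
    have hn0 : (0 : ℝ) < n := by exact_mod_cast (show 0 < n by omega)
    have hzone := sclV_fat_zone hge hq
    have hfold : kLfold L (sclV n q) = kL L (sclV n q) :=
      kLfold_eq_kL L (κ := 2 * rK d) (by linarith) hd16 (fun ν => (hzone ν).2) (fun ν => (hzone ν).1)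
    rw [hfold]
    have hp : ∀ μ, |(q μ).re| ≤ Real.pi * n ∧ |(q μ).im| ≤ kappaN d * n := by
      intro μ
      obtain ⟨h1, h2⟩ := hq μ
      have hπ := Real.pi_pos
      have hπ3 := Real.pi_gt_three
      have hnr : (2 : ℝ) ≤ n := by exact_mod_cast hge
      have hκN := (kappaF_pos d).le.trans (kappaF_le_kappaN d)
      refine ⟨h1.trans (by nlinarith), h2.trans (h2N.trans (by nlinarith))⟩
    have hb := norm_kL_scaled_le L hn hp
    have e : (fun μ => q μ / (n : ℂ)) = sclV n q := rfl
    rw [e] at hb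
    -- bound the quadratic form on the fat region
    have hsum : ∑ μ, ((q μ).re ^ 2 + 25 / 16 * (q μ).im ^ 2) ≤ (16 : ℝ) * d := by
      have hπ := Real.pi_lt_d2
      have hπ0 := Real.pi_pos
      calc ∑ μ, ((q μ).re ^ 2 + 25 / 16 * (q μ).im ^ 2) ≤ ∑ _μ : Fin d, (16 : ℝ) := by
            apply Finset.sum_le_sum; intro μ _
            obtain ⟨h1, h2⟩ := hq μ
            rw [abs_le] at h1 h2
            nlinarith
        _ = (16 : ℝ) * d := by simp [mul_comm]
    calc ‖(n : ℂ) ^ 2 * kL L (sclV n q)‖ ≤ (∑ μ, ((q μ).re ^ 2 + 25 / 16 * (q μ).im ^ 2)) / cN d := hb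
      _ ≤ 16 * d / cN d := div_le_div_of_nonneg_right hsum hcN.le
      _ ≤ 16 * d / cF d := div_le_div_of_nonneg_left (by positivity) hcF hc

/-! ### §6 Membership -/

/-- **THE SCALED FOLDED BLOCK-MEAN MULTIPLIER IS IN THE CLASS**: `n²·kLfold_L(·∕n) ∈ S(n; r_K(d), C_K(d), C_up,K(d))` for EVERY mesh
`n ≥ 1` and EVERY `L ≥ 1` — constants in `d` ALONE. [folklore] -/
theorem symbS_scaledKL (L : ℕ) [NeZero L] (n : ℕ) [NeZero n] : SymbS n (scaledKL (d := d) L n) (rK d) (CK d) (CupK d) := by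
  have hn : 1 ≤ n := Nat.one_le_iff_ne_zero.mpr (NeZero.ne n)
  obtain ⟨hr4, _, _, _, _, _⟩ := rK_facts d
  exact
    { r_pos := rK_pos d
      r_le := hr4
      cs_nonneg := CK_nonneg d
      small := rK_small d
      periodic := fun q μ => scaledKL_periodic L (NeZero.ne n) q μ
      holo := fun q hq => differentiableAt_scaledKL L hn hq
      real := fun s => scaledKL_real L n s
      floor := fun x η hη => scaledKL_floor L hn x η hη
      upper := fun q hq => norm_scaledKL_le L hn hq }

end Summit.QuantumFields.BalabanUV.T4Continuum.NE7K1LinStripClassKL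

end
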